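import Mathlib
import Literature.Combinatorics.Optimization.GaussianSignRounding
import HarnessLib

/-!
# Sherali–Adams gaps for MAX-CUT from local correlation matrices (Charikar–Makarychev–Makarychev
# 2009, the linear algebra of Theorem 5.2 and the deterministic core of Theorem 5.3)

[topic Combinatorics/Optimization]

Third file of the formalisation of the Charikar–Makarychev–Makarychev Sherali–Adams gap for
MAX-CUT (the tree's `CharikarMakarychevMakarychev2009_maxCutSA`).  It isolates what the printed
proof of Theorem 5.3 (p. 11) needs from the graph besides its combinatorics:

> **Theorem 5.3, proof.** "Consider a graph `G = (V, E)` with maximum degree `∆` such that 1. every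
> cut cuts at most `1/2 + ε/6` fraction of all edges; 2. every subgraph on `k` vertices is
> `Ω(log(n/k))`-path decomposable. … Applying Theorem 5.2 (with metric `ρ^alt_μ`) and Theorem 3.1,
> we get that the vector `x_ij = (1/π) arccos(1 − (4ρ^alt_μ(i,j) + μ)/(2(1 + μ)))` is a feasible
> solution of the Sherali–Adams relaxation. … The distance between every two adjacent vertices `i`
> and `j` is `ρ^alt_μ(i,j) = 1 − μ/2`, hence `x_ij = arccos(−1 + O(μ))/π = 1 − O(√μ) > 1 − ε/6` …
> the value of the optimal combinatorial solution is at most `(1/2 + ε/6)|E|`."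

and the linear algebra by which Theorem 5.2 (p. 9–10) manufactures the local sphere embeddings:

> **Theorem 5.2, proof.** "… there exists a random mapping `ϕ : B_d(Y, l) → {−1, 1}` satisfying the
> conditions of Corollary 5.1 … `‖ϕ(u) − ϕ(v)‖²₂ − 4ρ^π_μ(u,v) ≤ 4(1 − μ)^L ≤ μ/(2(k+1))` … Define
> the metric `σ(u,v) = √(μ + 4ρ^π_μ(u,v) − ‖ϕ(u) − ϕ(v)‖²)`, `σ(u,O) = √μ`.  By Lemma 2.5 the metric
> `σ` is Euclidean. Let `ν` be the direct sum of the isometric embedding of `(Y ∪ {O}, σ)` into `ℓ₂`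
> and the embedding `u ↦ ϕ(u)` … `‖ν(u) − ν(v)‖ = √(4ρ^π_μ(u,v) + μ)` … `‖ν(u)‖ = √(1 + μ)` …
> `ψ(u) = ν(u)/√(1 + μ)`."

**Gram-matrix rendering** (as in `GaussianSignRounding.lean`; deviation of form recorded there).
Write `F(u,v) = 1 − 2ρ(u,v)` for the TARGET CORRELATION (`F(u,u) = 1`; for `ρ = ρ^π_μ` this is
`π_uv (1−μ)^{d(u,v)}`, `= −(1−μ)` on an edge of MAX-CUT) and `P(u,v) = E[ϕ(u)ϕ(v)]` for the
correlation matrix of the local `±1` process on `Y` — a positive semidefinite matrix with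
`|P − F| ≤ η := 2(1−μ)^L` entrywise.  The Gram matrix of CMM's `ψ` is then
`K = (F + (μ/2)·J + (μ/2)·I)/(1 + μ)` (`J` = all ones): `K(u,u) = 1` and, on an edge,
`K(u,v) = (−(1−μ) + μ/2)/(1+μ) ≤ −1 + 5μ/2`.  The content of Lemma 2.5 + the direct sum is that
`K|_Y ⪰ 0`; in Gram form this is one line: `xᵀ F x ≥ xᵀ P x − η (Σ|x_i|)² ≥ −η|Y|‖x‖²`,
`xᵀ J x ≥ 0`, so `xᵀ((1+μ)K)x ≥ (μ/2 − η|Y|)‖x‖² ≥ 0` once `η|Y| ≤ μ/2`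
(`posSemidef_localCov_cmmKernel`).  (The printed route reaches the same Gram matrix through the
metric `σ` and Lemma 2.5 = [CMM10, Lemma 3.11]; only the Gram matrix is consumed by Theorem 3.1.)

Main result, **`not_SAAchieves_maxCut_of_localCorrelations`** (Thm 5.3 minus the graph theory): let
`E` be a nonempty loopless edge set on `[n]` all of whose cuts cut `≤ s|E|` edges, and `F` a
symmetric target correlation with unit diagonal, `F ≤ −1 + μ` on the edges of `E`, such that for every
vertex set `T` of size `≤ d` (`d ≥ 2`) some positive semidefinite `P` on `T` is entrywise `η`-close to
`F|_T`, where `d·η ≤ μ/2` and `40μ ≤ ε³`; then the degree-`d` Sherali–Adams relaxation does not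
achieve a `(c, s)`-approximation for MAX-CUT on `n` vertices for any `c < 1 − ε`.  (Theorem 3.1 =
`GaussianSignRounding.localExpectations`, Lemma 2.1 = `LocalExpectations.toSA`, edge value
`≥ 1 − ε` = `GaussianSignRounding.saE_cutFn_ge` with `δ = 5μ/2 ≤ ε³/16`.)  The remaining inputs of
Theorem 5.3 — the local `±1` processes (Cor. 5.1 from [CMM10, Thm 3.3] on the `l`-path-decomposable
balls `B(Y,l)`) and the random graphs — are the business of the sequel files.

Everything is proved; no named facts.

## References

* [CharikarMakarychevMakarychev2009] M. Charikar, K. Makarychev, Y. Makarychev, *Integrality gaps for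
  Sherali–Adams relaxations*, STOC 2009, doi:10.1145/1536414.1536455; Thm 3.1 (p. 6), Cor. 5.1 and
  Thm 5.2 (p. 8–10), Thm 5.3 (p. 11).  Held text `paper:doi-10-1145-1536414-1536455`.
* [CharikarMakarychevMakarychev2010] M. Charikar, K. Makarychev, Y. Makarychev, *Local global tradeoffs
  in metric embeddings*, SIAM J. Comput. 39 (2010) 2487–2512, doi:10.1137/070712080; Lemma 3.11
  (= CMM09 Lemma 2.5), Thm 3.3 (= CMM09 Thm 2.4).  Held text `paper:doi-10-1137-070712080`.
-/

noncomputable section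

open Finset Matrix

namespace Literature.Combinatorics.Optimization

namespace GaussianSignRounding

variable {n : ℕ}

/-! ### The corrected kernel of Theorem 5.2 -/

/-- **The Gram matrix of CMM's local sphere embedding `ψ`** as a global kernel:
`K(u,v) = (F(u,v) + μ/2 + [u = v]·μ/2)/(1 + μ)` for the target correlation `F = 1 − 2ρ`.
[cite: CharikarMakarychevMakarychev2009, Thm 5.2 proof (p. 10, "ψ(u) = ν(u)/√(1+μ)")] -/
def cmmKernel (F : Matrix (Fin n) (Fin n) ℝ) (μ : ℝ) : Matrix (Fin n) (Fin n) ℝ :=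
  fun u v => (F u v + μ / 2 + if u = v then μ / 2 else 0) / (1 + μ)

/-- The corrected kernel has unit diagonal when `F` does ("`‖ψ(u)‖ = 1`").
[cite: CharikarMakarychevMakarychev2009, Thm 5.2 proof (p. 10)] -/
theorem cmmKernel_diag {F : Matrix (Fin n) (Fin n) ℝ} (hF : ∀ u, F u u = 1) {μ : ℝ} (hμ : 0 ≤ μ)
    (u : Fin n) : cmmKernel F μ u u = 1 := by
  rw [cmmKernel, if_pos rfl, hF, div_eq_one_iff_eq (by positivity)]
  ring

/-- Off the diagonal `K(u,v) = (F(u,v) + μ/2)/(1+μ)`; in particular `F(u,v) ≤ −1 + μ` (an edge: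
`ρ = 1 − μ/2`) gives `K(u,v) ≤ −1 + 5μ/2` ("almost antipodal", `‖ψ(u) − ψ(v)‖² = (4−μ)/(1+μ)`).
[cite: CharikarMakarychevMakarychev2009, Thm 5.2 (p. 9, "almost antipodal points") and Thm 5.3 proof (p. 11)] -/
theorem cmmKernel_le_of_edge {F : Matrix (Fin n) (Fin n) ℝ} {μ : ℝ} (hμ : 0 ≤ μ) {u v : Fin n}
    (huv : u ≠ v) (hF : F u v ≤ -1 + μ) : cmmKernel F μ u v ≤ -1 + 5 * μ / 2 := by
  rw [cmmKernel, if_neg huv, add_zero, div_le_iff₀ (by positivity)]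
  nlinarith

/-- The corrected kernel is symmetric when `F` is. [cite: CharikarMakarychevMakarychev2009, Thm 5.2 proof (p. 10)] -/
theorem cmmKernel_symm {F : Matrix (Fin n) (Fin n) ℝ} (hF : ∀ u v, F u v = F v u) (μ : ℝ)
    (u v : Fin n) : cmmKernel F μ u v = cmmKernel F μ v u := by
  unfold cmmKernel
  rw [hF u v]
  by_cases h : u = v
  · subst h; rfl
  · rw [if_neg h, if_neg (Ne.symm h)]

/-- The real quadratic form of a matrix as a double sum. [folklore] -/
private theorem dotProduct_mulVec_eq_sum {ι : Type*} [Fintype ι] (M : Matrix ι ι ℝ) (x : ι → ℝ) :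
    star x ⬝ᵥ (M *ᵥ x) = ∑ i, ∑ j, x i * M i j * x j := by
  simp only [star_trivial, dotProduct, mulVec, Finset.mul_sum]
  refine Finset.sum_congr rfl fun i _ => Finset.sum_congr rfl fun j _ => ?_
  ring

/-- **Theorem 5.2, the Gram-matrix step (Lemma 2.5 + direct sum): the corrected kernel is positive
semidefinite on `T` as soon as some positive semidefinite matrix `P` on `T` is entrywise `η`-close to
the target correlation `F|_T` (`η ≥ 0`) and `|T|·η ≤ μ/2`.**  Proof:
`xᵀF x ≥ xᵀP x − η(Σ|x_i|)² ≥ −η|T|‖x‖²` (Cauchy–Schwarz), `xᵀJx = (Σx_i)² ≥ 0`, hence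
`xᵀ((1+μ)K)x ≥ (μ/2 − η|T|)‖x‖² ≥ 0`.
[cite: CharikarMakarychevMakarychev2009, Thm 5.2 proof (p. 9–10) and Lemma 2.5 (p. 5)] -/
theorem posSemidef_localCov_cmmKernel {F : Matrix (Fin n) (Fin n) ℝ} (hFsymm : ∀ u v, F u v = F v u)
    {μ η : ℝ} (hμ : 0 ≤ μ) (hη0 : 0 ≤ η) (T : Finset (Fin n)) (P : Matrix ↥T ↥T ℝ) (hP : P.PosSemidef)
    (hPF : ∀ i j : ↥T, |P i j - F i j| ≤ η) (hη : T.card * η ≤ μ / 2) :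
    (localCov (cmmKernel F μ) T).PosSemidef := by
  refine Matrix.PosSemidef.of_dotProduct_mulVec_nonneg ?_ fun x => ?_
  · refine Matrix.IsHermitian.ext fun i j => ?_
    simp only [localCov_apply, star_trivial]
    exact cmmKernel_symm hFsymm μ _ _
  rw [dotProduct_mulVec_eq_sum]
  -- the pieces of the quadratic form
  set A : ℝ := ∑ i : ↥T, ∑ j : ↥T, x i * F i j * x j with hA
  set C : ℝ := ∑ i : ↥T, x i ^ 2 with hC
  have hPx : 0 ≤ ∑ i, ∑ j, x i * P i j * x j := by
    rw [← dotProduct_mulVec_eq_sum]; exact hP.dotProduct_mulVec_nonneg x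
  -- `A − xᵀPx = Σ x_i (F_ij − P_ij) x_j ≥ −η (Σ|x_i|)²`
  have hdiff : -(η * (∑ i, |x i|) ^ 2) ≤ A - ∑ i, ∑ j, x i * P i j * x j := by
    have hsub : A - ∑ i, ∑ j, x i * P i j * x j = ∑ i : ↥T, ∑ j : ↥T, x i * (F i j - P i j) * x j := by
      rw [hA, ← Finset.sum_sub_distrib]
      refine Finset.sum_congr rfl fun i _ => ?_
      rw [← Finset.sum_sub_distrib]
      refine Finset.sum_congr rfl fun j _ => ?_
      ring
    rw [hsub, sq, Finset.sum_mul_sum, Finset.mul_sum, ← Finset.sum_neg_distrib]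
    refine Finset.sum_le_sum fun i _ => ?_
    rw [Finset.mul_sum, ← Finset.sum_neg_distrib]
    refine Finset.sum_le_sum fun j _ => ?_
    have h1 : |x i * (F i j - P i j) * x j| ≤ η * (|x i| * |x j|) := by
      rw [abs_mul, abs_mul]
      have hFP : |F i j - P i j| ≤ η := by rw [abs_sub_comm]; exact hPF i j
      calc |x i| * |F i j - P i j| * |x j| ≤ |x i| * η * |x j| := by gcongr
        _ = η * (|x i| * |x j|) := by ring
    linarith [neg_abs_le (x i * (F i j - P i j) * x j)]
  -- Cauchy–Schwarz: `(Σ|x_i|)² ≤ |T| Σ x_i²`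
  have hCS : (∑ i, |x i|) ^ 2 ≤ T.card * C := by
    have h := sq_sum_le_card_mul_sum_sq (s := (univ : Finset ↥T)) (f := fun i => |x i|)
    simp only [card_univ, Fintype.card_coe, sq_abs] at h
    exact h
  have hC0 : 0 ≤ C := Finset.sum_nonneg fun i _ => sq_nonneg _
  have hAge : -(μ / 2) * C ≤ A := by
    have h1 : η * (∑ i, |x i|) ^ 2 ≤ η * (T.card * C) := mul_le_mul_of_nonneg_left hCS hη0
    nlinarith
  -- the diagonal correction term
  have hdiag : ∀ i : ↥T, ∑ j : ↥T, x i * (if (i : Fin n) = j then μ / 2 else 0) * x j =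
      μ / 2 * x i ^ 2 := by
    intro i
    rw [Finset.sum_eq_single i]
    · simp; ring
    · intro j _ hj
      rw [if_neg (fun h => hj (Subtype.ext h).symm)]; ring
    · simp
  -- the numerator of the quadratic form
  have hnum : ∑ i : ↥T, ∑ j : ↥T, x i * (F i j + μ / 2 + if (i : Fin n) = j then μ / 2 else 0) * x j =
      A + μ / 2 * (∑ i, x i) ^ 2 + μ / 2 * C := by
    have hsplit : ∀ i j : ↥T, x i * (F i j + μ / 2 + if (i : Fin n) = j then μ / 2 else 0) * x j =
        x i * F i j * x j + μ / 2 * (x i * x j) +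
          x i * (if (i : Fin n) = j then μ / 2 else 0) * x j := fun i j => by ring
    simp_rw [hsplit, Finset.sum_add_distrib, hdiag, ← Finset.mul_sum]
    rw [hA, hC, sq, Finset.sum_mul_sum]
    simp_rw [Finset.mul_sum]
  have hquad : ∑ i : ↥T, ∑ j : ↥T, x i * localCov (cmmKernel F μ) T i j * x j =
      (∑ i : ↥T, ∑ j : ↥T, x i * (F i j + μ / 2 + if (i : Fin n) = j then μ / 2 else 0) * x j) / (1 + μ) := by
    rw [Finset.sum_div]
    refine Finset.sum_congr rfl fun i _ => ?_
    rw [Finset.sum_div]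
    refine Finset.sum_congr rfl fun j _ => ?_
    rw [localCov_apply, cmmKernel]
    ring
  rw [hquad, hnum]
  refine div_nonneg ?_ (by positivity)
  nlinarith [sq_nonneg (∑ i, x i)]

/-! ### Theorem 5.3, deterministic core -/

/-- **CMM Theorem 5.3 minus the graph theory.**  Let `E` be a nonempty loopless set of edges on `[n]`
whose every cut cuts at most `s|E|` edges; let `F` be a symmetric target correlation with unit
diagonal and `F(u,v) ≤ −1 + μ` on every edge of `E` (`μ ≥ 0`); suppose that for every `T ⊆ [n]` with
`|T| ≤ d` (`d ≥ 2`) some positive semidefinite matrix on `T` is entrywise `η`-close to `F|_T`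
(`η ≥ 0`, `d·η ≤ μ/2`), and `40μ ≤ ε³` (`ε > 0`).  Then the degree-`d` Sherali–Adams relaxation
of MAX-CUT on `n` vertices does not achieve a `(c, s)`-approximation for any `c < 1 − ε`: the
Gaussian sign rounding of the corrected kernel (Thm 5.2 + Thm 3.1) is a degree-`d` pseudoexpectation
(Lemma 2.1) giving every edge value `≥ 1 − ε`.
[cite: CharikarMakarychevMakarychev2009, Thm 5.3 (p. 11) with Thm 5.2 (p. 9–10), Thm 3.1 (p. 6), Lemma 2.1 (p. 4–5)] -/
theorem not_SAAchieves_maxCut_of_localCorrelations (E : Finset (Sym2 (Fin n))) (hE : E.Nonempty)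
    (hloop : ∀ e ∈ E, ¬ e.IsDiag) {s : ℝ} (hs : ∀ x : Fin n → Bool, ∑ e ∈ E, cutFn e x ≤ s * E.card)
    (F : Matrix (Fin n) (Fin n) ℝ) (hFsymm : ∀ u v, F u v = F v u) (hFdiag : ∀ u, F u u = 1)
    {μ η ε : ℝ} (hμ : 0 ≤ μ) (hη0 : 0 ≤ η) (hε : 0 < ε) (hμε : 40 * μ ≤ ε ^ 3)
    (hedge : ∀ u v : Fin n, s(u, v) ∈ E → F u v ≤ -1 + μ)
    {d : ℕ} (hd : 2 ≤ d) (hη : (d : ℝ) * η ≤ μ / 2)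
    (hloc : ∀ T : Finset (Fin n), T.card ≤ d →
      ∃ P : Matrix ↥T ↥T ℝ, P.PosSemidef ∧ ∀ i j : ↥T, |P i j - F i j| ≤ η)
    {c : ℝ} (hc : c < 1 - ε) :
    ¬ SAAchieves (n := n) maxCutPreds d c s := by
  -- the corrected kernel and its local positive semidefiniteness (Thm 5.2)
  set K := cmmKernel F μ with hKdef
  have hK : ∀ T : Finset (Fin n), T.card ≤ d → (localCov K T).PosSemidef := by
    intro T hT
    obtain ⟨P, hP, hPF⟩ := hloc T hT
    refine posSemidef_localCov_cmmKernel hFsymm hμ hη0 T P hP hPF (le_trans ?_ hη)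
    exact mul_le_mul_of_nonneg_right (by exact_mod_cast hT) hη0
  -- Thm 3.1 + Lemma 2.1: the pseudoexpectation, and the value of every edge
  refine not_SAAchieves_maxCut_of_localExpectations E hE hloop hs (localExpectations K d hK) ?_
  have hedgeval : ∀ e ∈ E, 1 - ε ≤ (localExpectations K d hK).saE (cutFn e) := by
    intro e he
    induction e using Sym2.ind with
    | h u v =>
      have huv : u ≠ v := fun h => hloop _ he (by subst h; exact Sym2.mk_isDiag_iff.2 rfl)
      refine saE_cutFn_ge K hK hd huv (cmmKernel_diag hFdiag hμ u) (cmmKernel_diag hFdiag hμ v)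
        (cmmKernel_le_of_edge hμ huv (hedge u v he)) hε ?_
      nlinarith
  calc c * E.card < (1 - ε) * E.card :=
        mul_lt_mul_of_pos_right hc (by exact_mod_cast card_pos.2 hE)
    _ = ∑ e ∈ E, (1 - ε) := by rw [sum_const, nsmul_eq_mul, mul_comm]
    _ ≤ ∑ e ∈ E, (localExpectations K d hK).saE (cutFn e) := sum_le_sum hedgeval

end GaussianSignRounding

end Literature.Combinatorics.Optimization

end
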